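import Summits.ValiantsHypothesis.ValiantsHypothesis.Theorems.ValuativeGCTValuativeBoundNegativeColumns
import Literature.RingTheory.MvPolynomial.VanishingOnSubspace

/-!
# `ValuativeBound` (stmt-ValiantsHypothesis-12625), negative side VI: the bound is TIGHT on every
one-row shape `λ = (mδ)`, for every `m ≥ 1` and every `(U, r, δ)` (cdisprove, cycle 3)

* `truncation_lastWeight_le_span` : `T(L, t, mδ, (0,…,0,-mδ)) ≤ ℂ ∙ det_m(A_last)^δ` for EVERY
  locus `L` and threshold `t`; hence `finrank_truncation_lastWeight_le_one` and, with the engine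
  `1 ≤ K_m((mδ)*)`, `finrank_truncation_indiscrete_le_orbitMultiplicity : dim T_U((mδ)) ≤ K_m((mδ)*)`
  — the REVERSE of the crux's inequality; given the crux both sides are `1`
  (`valuativeBound_tight_oneRow`): the constant cannot be improved at any `m`, the valuative cut
  never bites on one-row shapes, and the strict variant fails at every `m`.
Mechanism (no first fundamental theorem): Lemma R puts a weight-`(0,…,0,-mδ)` semi-invariant on the
last row, `G = g(A_last)` (`exists_rename_lastRow_eq`); the Stab clause at `rowOp P : x ↦ P·x`,
`det P = 1` (`linSubst_rowOp_detFormLex`) makes `g` left-`SL_m`-invariant; every invertible `x` is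
`P · diag(1,…,1,det x)` with `det P = 1`, so `g·det_m = g(diag(1,…,1,det_m))·det_m` pointwise, hence
as polynomials, so `g = h(det_m)` and homogeneity leaves `g = c·det_m^δ`
(`exists_eq_smul_detFormLex_pow`). [folklore]
-/

namespace Summit.ValiantsHypothesis.Theorems.ValuativeBoundNegative

open MvPolynomial
open Literature.NumberTheory.DiophantineGeometry Literature.Computability.AlgebraicComplexity

section TightOneRow

variable {m : ℕ}

/-! ### Matrices as points of `MatIdx m → ℂ` -/

/-- A matrix as a point of the coefficient space `MatIdx m → ℂ`. -/
def vecOf (A : Matrix (Fin m) (Fin m) ℂ) : MatIdx m → ℂ := fun i => A (ofLex i).1 (ofLex i).2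

/-- A point of `MatIdx m → ℂ` as a matrix. -/
def matOf (x : MatIdx m → ℂ) : Matrix (Fin m) (Fin m) ℂ := Matrix.of fun a b => x (toLex (a, b))

/-- Unfolding `vecOf` at a matrix position. -/
@[simp] theorem vecOf_toLex (A : Matrix (Fin m) (Fin m) ℂ) (a b : Fin m) :
    vecOf A (toLex (a, b)) = A a b := rfl

/-- Unfolding `matOf`. -/
@[simp] theorem matOf_apply (x : MatIdx m → ℂ) (a b : Fin m) : matOf x a b = x (toLex (a, b)) := rfl

/-- `vecOf ∘ matOf = id`. -/
theorem vecOf_matOf (x : MatIdx m → ℂ) : vecOf (matOf x) = x := by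
  funext i
  rw [← toLex_ofLex i, vecOf_toLex, matOf_apply]

/-- `det_m` evaluates to the determinant. -/
theorem eval_detFormLex (x : MatIdx m → ℂ) : eval x (detFormLex ℂ m) = (matOf x).det := by
  rw [detFormLex, eval_rename, eval_detPoly]
  rfl

/-- `det_m ≠ 0` (it is `1` at the identity matrix). -/
theorem detFormLex_ne_zero : detFormLex ℂ m ≠ 0 := by
  intro h
  have h1 := eval_detFormLex (vecOf (1 : Matrix (Fin m) (Fin m) ℂ))
  rw [h, map_zero] at h1
  have h2 : matOf (vecOf (1 : Matrix (Fin m) (Fin m) ℂ)) = 1 := by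
    ext a b; rfl
  rw [h2, Matrix.det_one] at h1
  exact zero_ne_one h1

/-- A sum over `MatIdx m` as a double sum over matrix positions. -/
theorem sum_matIdx {α : Type*} [AddCommMonoid α] (F : MatIdx m → α) :
    ∑ j : MatIdx m, F j = ∑ a : Fin m, ∑ b : Fin m, F (toLex (a, b)) := by
  rw [← Fintype.sum_prod_type']
  exact Fintype.sum_equiv toLex.symm _ _ (fun j => by
    rw [← toLex_ofLex j]
    rfl)

/-! ### The left multiplication substitutions `x ↦ P · x` lie in `Stab(det_m)` for `det P = 1` -/

/-- The substitution matrix of `x ↦ P · x` (matrix product, `x` the generic `m × m` matrix). -/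
def rowOp (P : Matrix (Fin m) (Fin m) ℂ) : Matrix (MatIdx m) (MatIdx m) ℂ :=
  fun j i => if (ofLex j).2 = (ofLex i).2 then P (ofLex i).1 (ofLex j).1 else 0

/-- `rowOp P` sends the variable `x_{ab}` to `∑_{a'} P_{a a'} x_{a' b} = (P·x)_{ab}`. -/
theorem linSubst_rowOp_X (P : Matrix (Fin m) (Fin m) ℂ) (a b : Fin m) :
    linSubst (MatIdx m) ℂ (rowOp P) (X (toLex (a, b))) =
      ∑ a' : Fin m, P a a' • (X (toLex (a', b)) : MvPolynomial (MatIdx m) ℂ) := by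
  rw [linSubst_X, sum_matIdx]
  refine Finset.sum_congr rfl fun a' _ => ?_
  rw [Finset.sum_eq_single b]
  · simp [rowOp]
  · intro b' _ hb'
    simp [rowOp, hb']
  · intro h; exact absurd (Finset.mem_univ _) h

/-- **`det_m(P·x) = det P · det_m(x)`** as a substitution identity. -/
theorem linSubst_rowOp_detFormLex (P : Matrix (Fin m) (Fin m) ℂ) :
    linSubst (MatIdx m) ℂ (rowOp P) (detFormLex ℂ m) = C P.det * detFormLex ℂ m := by
  rw [detFormLex, detPoly, AlgHom.map_det, AlgHom.map_det]
  have hmat : ((linSubst (MatIdx m) ℂ (rowOp P)).mapMatrix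
      ((rename toLex : MvPolynomial (Fin m × Fin m) ℂ →ₐ[ℂ] _).mapMatrix
        (Matrix.mvPolynomialX (Fin m) (Fin m) ℂ))) =
      P.map (C : ℂ →+* MvPolynomial (MatIdx m) ℂ) *
        (rename toLex : MvPolynomial (Fin m × Fin m) ℂ →ₐ[ℂ] _).mapMatrix
          (Matrix.mvPolynomialX (Fin m) (Fin m) ℂ) := by
    ext a b
    simp only [AlgHom.mapMatrix_apply, Matrix.map_apply, Matrix.mvPolynomialX_apply, rename_X,
      linSubst_rowOp_X, Matrix.mul_apply, smul_eq_C_mul]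
  rw [hmat, Matrix.det_mul, ← RingHom.mapMatrix_apply, ← RingHom.map_det]

/-- For `det P = 1` the substitution `x ↦ P·x` stabilises `det_m`. -/
theorem linSubst_rowOp_detFormLex_of_det_eq_one {P : Matrix (Fin m) (Fin m) ℂ} (hP : P.det = 1) :
    linSubst (MatIdx m) ℂ (rowOp P) (detFormLex ℂ m) = detFormLex ℂ m := by
  rw [linSubst_rowOp_detFormLex, hP, map_one, one_mul]

/-- Evaluating a linear substitution. -/
theorem eval_linSubst_eq (M : Matrix (MatIdx m) (MatIdx m) ℂ) (x : MatIdx m → ℂ)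
    (g : MvPolynomial (MatIdx m) ℂ) :
    eval x (linSubst (MatIdx m) ℂ M g) = eval (fun i => ∑ j, M j i * x j) g := by
  have hfun : (fun i => eval x (∑ j, M j i • (X j : MvPolynomial (MatIdx m) ℂ))) =
      fun i => ∑ j, M j i * x j := by
    funext i
    simp only [map_sum, smul_eval, eval_X]
  rw [linSubst, Literature.RingTheory.MvPolynomial.eval_aeval_eq_eval, hfun]

/-- `(x ↦ P·x)` on points: `g(rowOp P · x)` at the matrix `A` is `g` at `P * A`. -/
theorem eval_vecOf_linSubst_rowOp (P A : Matrix (Fin m) (Fin m) ℂ) (g : MvPolynomial (MatIdx m) ℂ) :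
    eval (vecOf A) (linSubst (MatIdx m) ℂ (rowOp P) g) = eval (vecOf (P * A)) g := by
  have hfun : (fun i => ∑ j, rowOp P j i * vecOf A j) = vecOf (P * A) := by
    funext i
    rw [← toLex_ofLex i, ← Prod.mk.eta (p := ofLex i), vecOf_toLex, Matrix.mul_apply, sum_matIdx]
    refine Finset.sum_congr rfl fun a' _ => ?_
    rw [Finset.sum_eq_single (ofLex i).2]
    · simp [rowOp]
    · intro b' _ hb'
      simp [rowOp, hb']
    · intro h; exact absurd (Finset.mem_univ _) h
  rw [eval_linSubst_eq, hfun]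

/-! ### `SL_m`-invariant forms of degree `mδ` on `Mat_m` are multiples of `det_m^δ` -/

section Core

variable [NeZero m]

/-- The last index of `Fin m`. -/
def aLast (m : ℕ) [NeZero m] : Fin m := ⟨m - 1, Nat.sub_one_lt (NeZero.ne m)⟩

/-- `iLast m` is the position `(aLast, aLast)`. -/
theorem iLast_eq_toLex : iLast m = toLex (aLast m, aLast m) := rfl

/-- `diag(1, …, 1, c)`. -/
def cornerDiag (c : ℂ) : Matrix (Fin m) (Fin m) ℂ :=
  Matrix.diagonal fun a => if a = aLast m then c else 1

/-- `det diag(1,…,1,c) = c`. -/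
theorem det_cornerDiag (c : ℂ) : (cornerDiag c : Matrix (Fin m) (Fin m) ℂ).det = c := by
  rw [cornerDiag, Matrix.det_diagonal, Finset.prod_ite_eq']
  simp

/-- `diag(1,…,1,c) · diag(1,…,1,d) = diag(1,…,1,cd)`. -/
theorem cornerDiag_mul_cornerDiag (c d : ℂ) :
    (cornerDiag c : Matrix (Fin m) (Fin m) ℂ) * cornerDiag d = cornerDiag (c * d) := by
  rw [cornerDiag, cornerDiag, cornerDiag, Matrix.diagonal_mul_diagonal]
  congr 1
  funext a
  split_ifs <;> simp

/-- `diag(1,…,1,1) = 1`. -/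
theorem cornerDiag_one : (cornerDiag 1 : Matrix (Fin m) (Fin m) ℂ) = 1 := by
  rw [cornerDiag, ← Matrix.diagonal_one]
  congr 1
  funext a
  split_ifs <;> rfl

/-- Every matrix with `det A ≠ 0` is `P · diag(1,…,1,det A)` with `det P = 1`. -/
theorem exists_eq_mul_cornerDiag {A : Matrix (Fin m) (Fin m) ℂ} (hA : A.det ≠ 0) :
    ∃ P : Matrix (Fin m) (Fin m) ℂ, P.det = 1 ∧ A = P * cornerDiag A.det := by
  refine ⟨A * cornerDiag (A.det)⁻¹, ?_, ?_⟩
  · rw [Matrix.det_mul, det_cornerDiag, mul_inv_cancel₀ hA]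
  · rw [Matrix.mul_assoc, cornerDiag_mul_cornerDiag, inv_mul_cancel₀ hA, cornerDiag_one, Matrix.mul_one]

/-- The substitution `x ↦ diag(1, …, 1, det_m(x))` (polynomial-valued). -/
noncomputable def cornerSubst (m : ℕ) [NeZero m] : MatIdx m → MvPolynomial (MatIdx m) ℂ :=
  fun i => if i = iLast m then detFormLex ℂ m else if (ofLex i).1 = (ofLex i).2 then 1 else 0

/-- The same substitution with a formal variable in the corner (univariate). -/
noncomputable def cornerSubstU (m : ℕ) [NeZero m] : MatIdx m → Polynomial ℂ :=
  fun i => if i = iLast m then Polynomial.X else if (ofLex i).1 = (ofLex i).2 then 1 else 0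

/-- The corner substitution evaluated at a point, entrywise. -/
theorem eval_cornerSubst_toLex (x : MatIdx m → ℂ) (a b : Fin m) :
    eval x (cornerSubst m (toLex (a, b))) = (cornerDiag (matOf x).det : Matrix (Fin m) (Fin m) ℂ) a b := by
  simp only [cornerSubst, cornerDiag, iLast_eq_toLex, ofLex_toLex, Matrix.diagonal_apply, toLex_inj,
    Prod.mk.injEq]
  by_cases hab : a = b
  · subst hab
    by_cases ha : a = aLast m
    · rw [if_pos ⟨ha, ha⟩, if_pos rfl, if_pos ha, eval_detFormLex]
    · rw [if_neg (fun h => ha h.1), if_pos rfl, if_pos rfl, if_neg ha, map_one]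
  · rw [if_neg (fun h => hab (h.1.trans h.2.symm)), if_neg hab, if_neg hab, map_zero]

/-- The corner substitution evaluated at a point `x` is the point `diag(1,…,1,det x)`. -/
theorem eval_cornerSubst (x : MatIdx m → ℂ) :
    (fun i => eval x (cornerSubst m i)) = vecOf (cornerDiag (matOf x).det) := by
  funext i
  have h := eval_cornerSubst_toLex x (ofLex i).1 (ofLex i).2
  rw [Prod.mk.eta, toLex_ofLex] at h
  exact h

/-- `g(diag(1,…,1,det_m)) = h(det_m)` for the univariate `h = g(diag(1,…,1,X))`. -/
theorem aeval_cornerSubst_eq (g : MvPolynomial (MatIdx m) ℂ) :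
    aeval (cornerSubst m) g = Polynomial.aeval (detFormLex ℂ m) (aeval (cornerSubstU m) g) := by
  have hs : (fun i => Polynomial.aeval (detFormLex ℂ m) (cornerSubstU m i)) = cornerSubst m := by
    funext i
    simp only [cornerSubst, cornerSubstU]
    split_ifs <;> simp
  rw [comp_aeval_apply, hs]

/-- **Core lemma.** A form of degree `mδ` on `Mat_m` invariant under `x ↦ P·x` for all `P` with
`det P = 1` is a scalar multiple of `det_m^δ`. -/
theorem exists_eq_smul_detFormLex_pow {δ : ℕ} {g : MvPolynomial (MatIdx m) ℂ}
    (hhom : g.IsHomogeneous (m * δ))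
    (hinv : ∀ P : Matrix (Fin m) (Fin m) ℂ, P.det = 1 → linSubst (MatIdx m) ℂ (rowOp P) g = g) :
    ∃ c : ℂ, g = c • detFormLex ℂ m ^ δ := by
  classical
  -- Step 1: `g = g(diag(1,…,1,det))` as polynomials, via `g · det = g(diag(…,det)) · det` pointwise.
  have hpt : ∀ A : Matrix (Fin m) (Fin m) ℂ, A.det ≠ 0 →
      eval (vecOf A) g = eval (vecOf (cornerDiag A.det)) g := by
    intro A hA
    obtain ⟨P, hP, hAP⟩ := exists_eq_mul_cornerDiag hA
    have h := congrArg (eval (vecOf (cornerDiag A.det))) (hinv P hP)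
    rw [eval_vecOf_linSubst_rowOp, ← hAP] at h
    exact h
  have hmul : g * detFormLex ℂ m = aeval (cornerSubst m) g * detFormLex ℂ m := by
    apply MvPolynomial.funext
    intro x
    rw [map_mul, map_mul, eval_detFormLex]
    by_cases hx : (matOf x).det = 0
    · rw [hx, mul_zero, mul_zero]
    · congr 1
      rw [Literature.RingTheory.MvPolynomial.eval_aeval_eq_eval, eval_cornerSubst]
      have h := hpt (matOf x) hx
      rwa [vecOf_matOf] at h
  have hg : g = Polynomial.aeval (detFormLex ℂ m) (aeval (cornerSubstU m) g) := by
    rw [← aeval_cornerSubst_eq]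
    exact mul_right_cancel₀ detFormLex_ne_zero hmul
  -- Step 2: expand `h(det)` in powers of `det` and take the degree-`mδ` component.
  set h : Polynomial ℂ := aeval (cornerSubstU m) g with hh
  rw [Polynomial.aeval_eq_sum_range] at hg
  have hcomp := congrArg (homogeneousComponent (m * δ)) hg
  rw [homogeneousComponent_of_mem hhom, if_pos rfl, map_sum] at hcomp
  have hterm : ∀ k ∈ Finset.range (h.natDegree + 1),
      homogeneousComponent (m * δ) (h.coeff k • detFormLex ℂ m ^ k) =
        if δ = k then h.coeff δ • detFormLex ℂ m ^ δ else 0 := by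
    intro k _
    rw [map_smul, homogeneousComponent_of_mem
      ((mem_homogeneousSubmodule _ _).mpr ((detFormLex_isHomogeneous ℂ m).pow k))]
    by_cases hk : δ = k
    · subst hk; rw [if_pos rfl, if_pos rfl]
    · have : m * δ ≠ m * k := fun h' => hk (Nat.eq_of_mul_eq_mul_left (NeZero.pos m) h')
      rw [if_neg this, if_neg hk, smul_zero]
  rw [Finset.sum_congr rfl hterm, Finset.sum_ite_eq] at hcomp
  by_cases hδ : δ ∈ Finset.range (h.natDegree + 1)
  · rw [if_pos hδ] at hcomp
    exact ⟨h.coeff δ, hcomp⟩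
  · rw [if_neg hδ] at hcomp
    exact ⟨0, by rw [hcomp, zero_smul]⟩

end Core

/-! ### From the truncation to the core lemma -/

section Transfer

variable [NeZero m]

/-- The last-row embedding of variables `l ↦ (iLast, l)`. -/
def lastRow (m : ℕ) [NeZero m] (l : MatIdx m) : MatIdx m × MatIdx m := (iLast m, l)

/-- `lastRow` is injective. -/
theorem lastRow_injective : Function.Injective (lastRow m) :=
  fun _ _ h => (Prod.ext_iff.mp h).2

/-- **Lemma R, packaged.** A semi-invariant of weight `(0,…,0,-n)` is a polynomial in the last-row
variables: `G = g(A_last)`. -/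
theorem exists_rename_lastRow_eq {n : ℕ} {G : MvPolynomial (MatIdx m × MatIdx m) ℂ}
    (hB : G ∈ borelSemiInvariants m (lastWeight m n)) :
    ∃ g : MvPolynomial (MatIdx m) ℂ, rename (lastRow m) g = G := by
  classical
  apply exists_rename_eq_of_vars_subset_range G (lastRow m) lastRow_injective
  intro p hp
  rw [Finset.mem_coe, mem_vars_iff_mem_support] at hp
  obtain ⟨e, he, hpe⟩ := hp
  have h1 : p.1 = iLast m := by
    by_contra hne
    exact (Finsupp.mem_support_iff.mp hpe) (apply_eq_zero_of_mem_borelSemiInvariants_lastWeight hB he hne)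
  exact ⟨p.2, Prod.ext h1.symm rfl⟩

/-- The Stab substitution restricted to the last row is `linSubst`. -/
theorem aeval_stabFun_comp_rename_lastRow (M : Matrix (MatIdx m) (MatIdx m) ℂ) :
    (aeval (R := ℂ) fun p : MatIdx m × MatIdx m =>
        ∑ l : MatIdx m, M l p.2 • (X (p.1, l) : MvPolynomial (MatIdx m × MatIdx m) ℂ)).comp
      (rename (lastRow m)) =
    (rename (lastRow m)).comp (linSubst (MatIdx m) ℂ M) := by
  apply MvPolynomial.algHom_ext
  intro i
  simp only [AlgHom.comp_apply, rename_X, aeval_X, linSubst_X, map_sum, map_smul]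
  rfl

/-- **The Stab clause descends to the last row**: if `g(A_last)` is right-`Stab(det_m)`-invariant
then `g ∘ M = g` for every `M ∈ Stab(det_m)`. -/
theorem linSubst_eq_of_rename_mem_stabInvariants {g : MvPolynomial (MatIdx m) ℂ}
    (hS : rename (lastRow m) g ∈ stabInvariants m) {M : Matrix (MatIdx m) (MatIdx m) ℂ}
    (hM : linSubst (MatIdx m) ℂ M (detFormLex ℂ m) = detFormLex ℂ m) :
    linSubst (MatIdx m) ℂ M g = g := by
  have h := (mem_stabInvariants_iff.mp hS) M hM
  have h2 := AlgHom.congr_fun (aeval_stabFun_comp_rename_lastRow (m := m) M) g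
  simp only [AlgHom.comp_apply] at h2
  rw [h2] at h
  exact rename_injective _ lastRow_injective h

/-- **`T ⊆ ℂ · det_m(A_last)^δ` on the one-row weight**, for every locus `L` and threshold `t`. -/
theorem truncation_lastWeight_le_span (L : Set (MatIdx m × MatIdx m → ℂ)) (t δ : ℕ) :
    truncation m L t (m * δ) (lastWeight m (m * δ)) ≤
      ℂ ∙ rename (lastRow m) (detFormLex ℂ m ^ δ) := by
  intro G hG
  rw [mem_truncation_iff] at hG
  obtain ⟨hH, -, hS, hB⟩ := hG
  obtain ⟨g, rfl⟩ := exists_rename_lastRow_eq hB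
  have hhom : g.IsHomogeneous (m * δ) :=
    (IsHomogeneous.rename_isHomogeneous_iff lastRow_injective).mp ((mem_homogeneousSubmodule _ _).mp hH)
  have hinv : ∀ P : Matrix (Fin m) (Fin m) ℂ, P.det = 1 → linSubst (MatIdx m) ℂ (rowOp P) g = g :=
    fun P hP => linSubst_eq_of_rename_mem_stabInvariants hS (linSubst_rowOp_detFormLex_of_det_eq_one hP)
  obtain ⟨c, hc⟩ := exists_eq_smul_detFormLex_pow hhom hinv
  rw [Submodule.mem_span_singleton]
  exact ⟨c, by rw [hc, map_smul]⟩

/-- `det_m(A_last)^δ ≠ 0`. -/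
theorem rename_lastRow_detFormLex_pow_ne_zero (δ : ℕ) :
    rename (lastRow m) (detFormLex ℂ m ^ δ) ≠ 0 := by
  rw [Ne, ← map_zero (rename (lastRow m)), (rename_injective _ lastRow_injective).eq_iff]
  exact pow_ne_zero δ detFormLex_ne_zero

/-- **`dim T ≤ 1` on the one-row weight**, for every `m ≥ 1`, locus, threshold and `δ`. -/
theorem finrank_truncation_lastWeight_le_one (L : Set (MatIdx m × MatIdx m → ℂ)) (t δ : ℕ) :
    Module.finrank ℂ (truncation m L t (m * δ) (lastWeight m (m * δ))) ≤ 1 := by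
  have hle := truncation_lastWeight_le_span (m := m) L t δ
  haveI : FiniteDimensional ℂ (ℂ ∙ rename (lastRow m) (detFormLex ℂ m ^ δ)) :=
    FiniteDimensional.span_singleton ℂ _
  haveI : FiniteDimensional ℂ (truncation m L t (m * δ) (lastWeight m (m * δ))) :=
    Submodule.finiteDimensional_of_le hle
  exact (Submodule.finrank_mono hle).trans
    (finrank_span_singleton (rename_lastRow_detFormLex_pow_ne_zero (m := m) δ)).le

/-- **THE REVERSE INEQUALITY on one-row shapes (tightness at every `m`).** For every `m ≥ 1`,
every `U`, `r`, `δ`: `dim T_U((mδ)) ≤ 1 ≤ K_m((mδ)*)`, with the crux's own locus, threshold and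
weight. No rank hypothesis on `U` is needed for this direction. -/
theorem finrank_truncation_indiscrete_le_orbitMultiplicity (U : Submodule ℂ (MatIdx m → ℂ)) (r δ : ℕ) :
    Module.finrank ℂ (truncation m (rowLocus m U) (δ * (m - r)) (m * δ)
        (Weight.dualOfPartition (m * m) (Nat.Partition.indiscrete (m * δ))).toMatIdx) ≤
      orbitMultiplicity ℂ (detFormLex ℂ m) m
        (Weight.dualOfPartition (m * m) (Nat.Partition.indiscrete (m * δ))).toMatIdx := by
  rw [toMatIdx_dualOfPartition_indiscrete]
  exact (finrank_truncation_lastWeight_le_one _ _ δ).trans (one_le_orbitMultiplicity_det_lastWeight m δ)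

/-- **Tightness, stated against the crux**: `ValuativeBound` forces `K_m((mδ)*) = dim T_U((mδ)) = 1`
for every `m ≥ 1`, every rank-bounded `U`, every `δ`. -/
theorem valuativeBound_tight_oneRow
    (hVB : Summit.ValiantsHypothesis.ValiantsHypothesis.Theses.ValuativeGCT.ValuativeBound)
    (U : Submodule ℂ (MatIdx m → ℂ)) (r : ℕ)
    (hU : ∀ u ∈ U, (Matrix.of fun a b : Fin m => u (toLex (a, b))).rank ≤ r) (δ : ℕ) :
    orbitMultiplicity ℂ (detFormLex ℂ m) m
        (Weight.dualOfPartition (m * m) (Nat.Partition.indiscrete (m * δ))).toMatIdx =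
      Module.finrank ℂ (truncation m (rowLocus m U) (δ * (m - r)) (m * δ)
        (Weight.dualOfPartition (m * m) (Nat.Partition.indiscrete (m * δ))).toMatIdx) ∧
    Module.finrank ℂ (truncation m (rowLocus m U) (δ * (m - r)) (m * δ)
        (Weight.dualOfPartition (m * m) (Nat.Partition.indiscrete (m * δ))).toMatIdx) = 1 := by
  have hle := (valuativeBound_iff.mp hVB) m U r hU δ (Nat.Partition.indiscrete (m * δ))
    (card_parts_indiscrete_le m _)
  have hge := finrank_truncation_indiscrete_le_orbitMultiplicity (m := m) U r δ
  have h1 := one_le_orbitMultiplicity_det_indiscrete m δ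
  have h2 : Module.finrank ℂ (truncation m (rowLocus m U) (δ * (m - r)) (m * δ)
      (Weight.dualOfPartition (m * m) (Nat.Partition.indiscrete (m * δ))).toMatIdx) ≤ 1 := by
    rw [toMatIdx_dualOfPartition_indiscrete]
    exact finrank_truncation_lastWeight_le_one _ _ δ
  omega

/-- **The STRICT variant fails at every `m ≥ 1`** (not only at `m = 1`, `valuativeBound_false_strict`):
on the one-row shape `dim T ≤ 1 ≤ K`. -/
theorem not_orbitMultiplicity_lt_finrank_truncation_indiscrete (U : Submodule ℂ (MatIdx m → ℂ)) (r δ : ℕ) :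
    ¬ orbitMultiplicity ℂ (detFormLex ℂ m) m
        (Weight.dualOfPartition (m * m) (Nat.Partition.indiscrete (m * δ))).toMatIdx <
      Module.finrank ℂ (truncation m (rowLocus m U) (δ * (m - r)) (m * δ)
        (Weight.dualOfPartition (m * m) (Nat.Partition.indiscrete (m * δ))).toMatIdx) :=
  not_lt.mpr (finrank_truncation_indiscrete_le_orbitMultiplicity U r δ)

end Transfer

end TightOneRow

end Summit.ValiantsHypothesis.Theorems.ValuativeBoundNegative
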